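import Literature.Analysis.FluidPDE.LoopCirculation
import Literature.Analysis.Calculus.PlanarPolarIntegral
import Mathlib.Analysis.InnerProductSpace.Projection.FiniteDimensional
import Mathlib.LinearAlgebra.CrossProduct
import Mathlib.MeasureTheory.Constructions.Pi
import Mathlib.MeasureTheory.Group.Measure
import HarnessLib

/-!
# Ball fluxes of the vorticity from small circulations
# (birth line of the crux `TautLoopKelvin.CirculationFloor`)

Helper file (supports the crux item `stmt-NavierStokesRegularity-1538`) proving the registered stub
`stub_ballFlux_of_smallCircles` of the birth skeleton `Cruxes/CirculationFloor/Lines/birth.lean` —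
the static first step of the contrapositive chain: if every planar circle of radius `≤ δ` has
circulation of modulus `≤ ε`, then every ball of radius `ρ ≤ δ` carries normal vorticity flux
`|∫_{B_ρ(x)} ⟪curl v, n⟫| ≤ 2ρε`.

Proof. Complete the unit normal `n` to an orthonormal frame `(n, e₁, e₂)` with `e₁ × e₂ = n`
(`ballFlux_frame`), parametrise `ℝ³` by `(h, a, b) ↦ x + h n + a e₁ + b e₂` (volume preserving,
`ballFlux_measurePreserving`), so that the ball becomes `{h² + a² + b² < ρ²}`; by Fubini the ball
integral is the `h`-integral of the fluxes through the discs `{a² + b² < ρ² − h²}`, `|h| < ρ`, and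
by planar polar coordinates (Mathlib `integral_comp_polarCoord_symm`) and the tree's Stokes theorem
on planar discs (`Literature.Analysis.FluidPDE.circulation_circleLoop_eq_integral_curl`,
`circulation_circleLoop`) each disc flux is the circulation of its boundary circle, of radius
`√(ρ² − h²) ∈ (0, δ]` (`ballFlux_disc`), hence of modulus `≤ ε`; the `h`-integral over `(−ρ, ρ)`
gives `2ρε`.

## Main statements

* `ballFlux_frame`: an orthonormal frame `(e₁, e₂)` normal to a unit vector `n` with `e₁ × e₂ = n`.
* `ballFlux_measurePreserving`: the affine parametrisation adapted to an orthonormal frame of `ℝ³`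
  preserves Lebesgue measure.
* `ballFlux_disc`: the flux of `curl v` through a planar disc, as a set integral over the
  coordinate disc, equals the circulation angle integral of the boundary circle.
* `stub_ballFlux_of_smallCircles`: the registered stub, verbatim (last theorem of the file).
-/

noncomputable section

open Set MeasureTheory Filter Topology Real
open scoped RealInnerProductSpace

set_option linter.dupNamespace false

namespace Summit.NavierStokesRegularity.NavierStokesRegularity.Theorems.CirculationFloor.Birth

open Literature.Analysis.FluidPDE

/-- **An oriented orthonormal frame normal to a unit vector.** For a unit vector `n ∈ ℝ³` there are
unit vectors `e₁ ⊥ e₂`, both orthogonal to `n`, with `e₁ × e₂ = n` (take a unit `e₁ ∈ (ℝ n)ᗮ`,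
which is two-dimensional, and `e₂ := n × e₁`; then `e₁ × (n × e₁) = ‖e₁‖² n − ⟪e₁, n⟫ e₁ = n`). -/
theorem ballFlux_frame (n : EuclideanSpace ℝ (Fin 3)) (hn : ‖n‖ = 1) :
    ∃ e₁ e₂ : EuclideanSpace ℝ (Fin 3), ‖e₁‖ = 1 ∧ ‖e₂‖ = 1 ∧ ⟪e₁, e₂⟫ = 0 ∧ ⟪n, e₁⟫ = 0 ∧
      ⟪n, e₂⟫ = 0 ∧ cross e₁ e₂ = n := by
  have hn0 : n ≠ 0 := by
    rintro rfl
    simp at hn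
  haveI : Fact (Module.finrank ℝ (EuclideanSpace ℝ (Fin 3)) = 2 + 1) := ⟨by simp⟩
  have hrank : Module.finrank ℝ (ℝ ∙ n)ᗮ = 2 := Submodule.finrank_orthogonal_span_singleton hn0
  haveI : Nontrivial (ℝ ∙ n)ᗮ := Module.nontrivial_of_finrank_pos (R := ℝ) (by omega)
  obtain ⟨u, hu⟩ := exists_norm_eq ((ℝ ∙ n)ᗮ) zero_le_one
  set e : EuclideanSpace ℝ (Fin 3) := (u : EuclideanSpace ℝ (Fin 3)) with he_def
  have he : ‖e‖ = 1 := by simpa [he_def] using hu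
  have hne : ⟪n, e⟫ = 0 := (Submodule.mem_orthogonal_singleton_iff_inner_right).1 u.2
  have hE : e 0 ^ 2 + e 1 ^ 2 + e 2 ^ 2 = 1 := by
    have h := EuclideanSpace.real_norm_sq_eq e
    rw [he, Fin.sum_univ_three] at h
    linarith
  have hI : n 0 * e 0 + n 1 * e 1 + n 2 * e 2 = 0 := by
    simpa [PiLp.inner_apply, Fin.sum_univ_three, mul_comm] using hne
  refine ⟨e, cross n e, he, ?_, ?_, hne, ?_, ?_⟩
  · rw [norm_cross, hn, he, (InnerProductGeometry.inner_eq_zero_iff_angle_eq_pi_div_two n e).1 hne,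
      Real.sin_pi_div_two]
    norm_num
  · simp [cross, cross_apply, PiLp.inner_apply, Fin.sum_univ_three]
    ring
  · simp [cross, cross_apply, PiLp.inner_apply, Fin.sum_univ_three]
    ring
  · ext i
    fin_cases i
    · simp [cross, cross_apply]
      linear_combination (n 0) * hE - (e 0) * hI
    · simp [cross, cross_apply]
      linear_combination (n 1) * hE - (e 1) * hI
    · simp [cross, cross_apply]
      linear_combination (n 2) * hE - (e 2) * hI

/-- Six scalar relations make `(n, e₁, e₂)` an orthonormal family indexed by `Fin 3`. -/
theorem ballFlux_orthonormal {n e₁ e₂ : EuclideanSpace ℝ (Fin 3)} (hn : ‖n‖ = 1) (he₁ : ‖e₁‖ = 1)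
    (he₂ : ‖e₂‖ = 1) (h12 : ⟪e₁, e₂⟫ = 0) (hn1 : ⟪n, e₁⟫ = 0) (hn2 : ⟪n, e₂⟫ = 0) :
    Orthonormal ℝ ![n, e₁, e₂] := by
  rw [orthonormal_iff_ite]
  intro i j
  fin_cases i <;> fin_cases j <;>
    simp [hn, he₁, he₂, h12, hn1, hn2, real_inner_comm n e₁, real_inner_comm n e₂,
      real_inner_comm e₁ e₂]

/-- Pythagoras in the orthonormal frame: `‖h n + a e₁ + b e₂‖² = h² + a² + b²`. -/
theorem ballFlux_norm_sq {n e₁ e₂ : EuclideanSpace ℝ (Fin 3)} (hn : ‖n‖ = 1) (he₁ : ‖e₁‖ = 1)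
    (he₂ : ‖e₂‖ = 1) (h12 : ⟪e₁, e₂⟫ = 0) (hn1 : ⟪n, e₁⟫ = 0) (hn2 : ⟪n, e₂⟫ = 0) (h a b : ℝ) :
    ‖h • n + a • e₁ + b • e₂‖ ^ 2 = h ^ 2 + a ^ 2 + b ^ 2 := by
  have hnn : ⟪n, n⟫ = 1 := by rw [real_inner_self_eq_norm_sq, hn, one_pow]
  have h11 : ⟪e₁, e₁⟫ = 1 := by rw [real_inner_self_eq_norm_sq, he₁, one_pow]
  have h22 : ⟪e₂, e₂⟫ = 1 := by rw [real_inner_self_eq_norm_sq, he₂, one_pow]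
  rw [← real_inner_self_eq_norm_sq]
  simp only [inner_add_left, inner_add_right, real_inner_smul_left, real_inner_smul_right, hnn,
    h11, h22, h12, hn1, hn2, real_inner_comm n e₁, real_inner_comm n e₂, real_inner_comm e₁ e₂]
  ring

/-- **The adapted affine parametrisation is volume preserving.** For an orthonormal frame
`(n, e₁, e₂)` of `ℝ³` and a base point `x`, the map `(h, (a, b)) ↦ x + h n + a e₁ + b e₂` from
`ℝ × (ℝ × ℝ)` to `ℝ³` preserves Lebesgue measure: it is the composite of the volume-preserving
identifications `ℝ × (ℝ × ℝ) ≃ ℝ × (Fin 2 → ℝ) ≃ (Fin 3 → ℝ) ≃ EuclideanSpace ℝ (Fin 3)`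
(Mathlib `volume_preserving_finTwoArrow`, `volume_preserving_piFinSuccAbove`,
`PiLp.volume_preserving_toLp`), the linear isometry `(OrthonormalBasis.mk _).repr.symm`
(`OrthonormalBasis.measurePreserving_repr_symm`) and a translation. -/
theorem ballFlux_measurePreserving (x n e₁ e₂ : EuclideanSpace ℝ (Fin 3))
    (hon : Orthonormal ℝ ![n, e₁, e₂]) :
    MeasurePreserving (fun p : ℝ × (ℝ × ℝ) => x + p.1 • n + p.2.1 • e₁ + p.2.2 • e₂) := by
  set b : OrthonormalBasis (Fin 3) ℝ (EuclideanSpace ℝ (Fin 3)) := OrthonormalBasis.mk hon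
    (hon.linearIndependent.span_eq_top_of_card_eq_finrank (by simp)).ge with hb
  have h1 : MeasurePreserving
      (Prod.map id MeasurableEquiv.finTwoArrow.symm : ℝ × (ℝ × ℝ) → ℝ × (Fin 2 → ℝ)) :=
    (MeasurePreserving.id volume).prod (volume_preserving_finTwoArrow ℝ).symm
  have h2 : MeasurePreserving (MeasurableEquiv.piFinSuccAbove (fun _ : Fin 3 => ℝ) 0).symm :=
    (volume_preserving_piFinSuccAbove (fun _ : Fin 3 => ℝ) 0).symm
  have h3 : MeasurePreserving (@WithLp.toLp 2 (Fin 3 → ℝ)) := PiLp.volume_preserving_toLp (Fin 3)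
  have h5 : MeasurePreserving (fun y : EuclideanSpace ℝ (Fin 3) => x + y) :=
    measurePreserving_add_left volume x
  convert h5.comp (b.measurePreserving_repr_symm.comp (h3.comp (h2.comp h1))) using 1
  funext p
  simp only [Function.comp_apply, MeasurableEquiv.finTwoArrow_symm_apply,
    MeasurableEquiv.piFinSuccAbove_symm_apply]
  rw [← b.sum_repr_symm, Fin.sum_univ_three]
  simp [hb, add_assoc]

/-- The normal vorticity `y ↦ ⟪curl v y, a × b⟫ = ⟪Dv(y) a, b⟫ − ⟪Dv(y) b, a⟫` of a `C¹` field is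
continuous (`inner_curl_cross`). -/
theorem ballFlux_continuous_inner_curl {v : EuclideanSpace ℝ (Fin 3) → EuclideanSpace ℝ (Fin 3)}
    (hv : ContDiff ℝ 1 v) (a b : EuclideanSpace ℝ (Fin 3)) :
    Continuous fun y => ⟪curl v y, cross a b⟫ := by
  simp_rw [inner_curl_cross]
  have hD := hv.continuous_fderiv one_ne_zero
  exact ((hD.clm_apply continuous_const).inner continuous_const).sub
    ((hD.clm_apply continuous_const).inner continuous_const)

/-- **Disc flux = boundary circulation, as a set integral.** For a `C¹` field `v` on `ℝ³`, a
centre `c`, a frame `(e₁, e₂)` and `R > 0`, the integral of the normal vorticity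
`⟪curl v (c + a e₁ + b e₂), e₁ × e₂⟫` over the coordinate disc `{a² + b² < R²}` equals the
circulation angle integral `∫₀^{2π} ⟪v(c + R cos θ e₁ + R sin θ e₂), −R sin θ e₁ + R cos θ e₂⟫ dθ`
of the boundary circle: planar polar coordinates (`integral_comp_polarCoord_symm`, Fubini on
`(0, R) × (−π, π)`, `2π`-periodicity in the angle) followed by the tree's Stokes theorem on planar
discs `circulation_circleLoop_eq_integral_curl` and `circulation_circleLoop`. -/
theorem ballFlux_disc {v : EuclideanSpace ℝ (Fin 3) → EuclideanSpace ℝ (Fin 3)}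
    (hv : ContDiff ℝ 1 v) (c e₁ e₂ : EuclideanSpace ℝ (Fin 3)) {R : ℝ} (hR : 0 < R) :
    ∫ q in {q : ℝ × ℝ | q.1 ^ 2 + q.2 ^ 2 < R ^ 2},
        ⟪curl v (c + q.1 • e₁ + q.2 • e₂), cross e₁ e₂⟫ =
      ∫ θ in (0 : ℝ)..2 * π, ⟪v (c + (R * cos θ) • e₁ + (R * sin θ) • e₂),
        (-(R * sin θ)) • e₁ + (R * cos θ) • e₂⟫ := by
  set G : ℝ × ℝ → ℝ := fun q => ⟪curl v (c + q.1 • e₁ + q.2 • e₂), cross e₁ e₂⟫ with hG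
  have hGc : Continuous G :=
    (ballFlux_continuous_inner_curl hv e₁ e₂).comp (by fun_prop : Continuous fun q : ℝ × ℝ =>
      c + q.1 • e₁ + q.2 • e₂)
  set D : Set (ℝ × ℝ) := {q | q.1 ^ 2 + q.2 ^ 2 < R ^ 2} with hD
  have hDm : MeasurableSet D := (isOpen_lt (by fun_prop) continuous_const).measurableSet
  set Φ : ℝ × ℝ → ℝ := fun p => p.1 * G (p.1 * cos p.2, p.1 * sin p.2) with hΦ
  have hΦc : Continuous Φ := continuous_fst.mul (hGc.comp (by fun_prop))
  -- the polar integrand on `polarCoord.target`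
  have hpt : ∀ p ∈ polarCoord.target,
      p.1 • D.indicator G (polarCoord.symm p) = (Iio R ×ˢ univ).indicator Φ p := by
    intro p hp
    rw [polarCoord_target] at hp
    have hr : 0 < p.1 := hp.1
    have hmem : polarCoord.symm p ∈ D ↔ p.1 < R := by
      simp only [polarCoord_symm_apply, hD, mem_setOf_eq]
      rw [show (p.1 * cos p.2) ^ 2 + (p.1 * sin p.2) ^ 2 = p.1 ^ 2 by
        nlinarith [sin_sq_add_cos_sq p.2]]
      exact sq_lt_sq₀ hr.le hR.le
    by_cases h : p.1 < R
    · rw [indicator_of_mem (hmem.2 h), indicator_of_mem (show p ∈ Iio R ×ˢ univ from ⟨h, trivial⟩),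
        polarCoord_symm_apply, smul_eq_mul]
    · rw [indicator_of_notMem (mt hmem.1 h), indicator_of_notMem (fun hp' => h hp'.1), smul_zero]
  have hper : ∀ r : ℝ, Function.Periodic (fun θ => Φ (r, θ)) (2 * π) := fun r θ => by
    simp [hΦ]
  calc ∫ q in D, G q = ∫ q, D.indicator G q := (integral_indicator hDm).symm
    _ = ∫ p in polarCoord.target, p.1 • D.indicator G (polarCoord.symm p) :=
        (integral_comp_polarCoord_symm _).symm
    _ = ∫ p in polarCoord.target, (Iio R ×ˢ univ).indicator Φ p :=
        setIntegral_congr_fun polarCoord.open_target.measurableSet hpt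
    _ = ∫ p in Ioo 0 R ×ˢ Ioo (-π) π, Φ p := by
        rw [setIntegral_indicator (measurableSet_Iio.prod MeasurableSet.univ), polarCoord_target,
          prod_inter_prod, Ioi_inter_Iio, inter_univ]
    _ = ∫ r in Ioo 0 R, ∫ θ in Ioo (-π) π, Φ (r, θ) := by
        rw [Measure.volume_eq_prod ℝ ℝ, setIntegral_prod]
        exact (hΦc.continuousOn.integrableOn_compact (isCompact_Icc.prod isCompact_Icc)).mono_set
          (prod_mono Ioo_subset_Icc_self Ioo_subset_Icc_self)
    _ = ∫ r in (0 : ℝ)..R, ∫ θ in (0 : ℝ)..2 * π, Φ (r, θ) := by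
        rw [intervalIntegral.integral_of_le hR.le, integral_Ioc_eq_integral_Ioo]
        refine setIntegral_congr_fun measurableSet_Ioo fun r _ => ?_
        have h1 := (hper r).intervalIntegral_add_eq (-π) 0
        rwa [zero_add, show -π + 2 * π = π by ring,
          intervalIntegral.integral_of_le (show -π ≤ π by linarith [pi_pos]),
          integral_Ioc_eq_integral_Ioo] at h1
    _ = circulation v (circleLoop c R e₁ e₂) := by
        rw [circulation_circleLoop_eq_integral_curl hv]
    _ = _ := circulation_circleLoop v c R e₁ e₂

/-- **stub 1 — `stub_ballFlux_of_smallCircles` (M; static geometry, KNOWN MECHANISM).** For a `C¹`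
vector field `v` on `ℝ³` and `δ > 0`, `ε ≥ 0`: if every planar circle of radius `0 < r ≤ δ` (any
centre, any orthonormal frame) has circulation `|∮ v·dl| ≤ ε` (the route's angle integral), then for
every point `x`, unit vector `n` and radius `0 < ρ ≤ δ` the flux of `curl v` through the ball in
direction `n` satisfies `|∫_{B_ρ(x)} ⟪curl v y, n⟫ dy| ≤ 2ρε`: slice `B_ρ(x)` by the discs normal to
`n` at heights `h ∈ (−ρ, ρ)` (frame `ballFlux_frame` with `e₁ × e₂ = n`, volume-preserving
parametrisation `ballFlux_measurePreserving`, Fubini); each disc has radius `√(ρ² − h²) ≤ δ` and its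
flux is the circulation of its boundary circle (`ballFlux_disc`, i.e. the tree's Stokes theorem
`Literature.Analysis.FluidPDE.circulation_circleLoop_eq_integral_curl` + `circulation_circleLoop`),
of modulus `≤ ε`; integrating over `h ∈ (−ρ, ρ)` gives `2ρε`. -/
theorem stub_ballFlux_of_smallCircles :
    ∀ (v : EuclideanSpace ℝ (Fin 3) → EuclideanSpace ℝ (Fin 3)), ContDiff ℝ 1 v →
      ∀ (δ ε : ℝ), 0 < δ → 0 ≤ ε →
        (∀ (c e₁ e₂ : EuclideanSpace ℝ (Fin 3)) (r : ℝ), 0 < r → r ≤ δ → ‖e₁‖ = 1 → ‖e₂‖ = 1 →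
            inner ℝ e₁ e₂ = 0 →
            |∫ θ in (0 : ℝ)..(2 * Real.pi), inner ℝ (v (c + (r * Real.cos θ) • e₁ + (r * Real.sin θ) • e₂))
                ((-(r * Real.sin θ)) • e₁ + (r * Real.cos θ) • e₂)| ≤ ε) →
        ∀ (x n : EuclideanSpace ℝ (Fin 3)) (ρ : ℝ), ‖n‖ = 1 → 0 < ρ → ρ ≤ δ →
          |∫ y in Metric.ball x ρ, inner ℝ (Literature.Analysis.FluidPDE.curl v y) n| ≤ 2 * ρ * ε := by
  intro v hv δ ε _hδ _hε hcirc x n ρ hn hρ hρδ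
  obtain ⟨e₁, e₂, he₁, he₂, h12, hn1, hn2, hcross⟩ := ballFlux_frame n hn
  have hon : Orthonormal ℝ ![n, e₁, e₂] := ballFlux_orthonormal hn he₁ he₂ h12 hn1 hn2
  -- the adapted parametrisation and the pulled-back ball
  set T : ℝ × (ℝ × ℝ) → EuclideanSpace ℝ (Fin 3) :=
    fun p => x + p.1 • n + p.2.1 • e₁ + p.2.2 • e₂ with hT
  have hTmp : MeasurePreserving T := ballFlux_measurePreserving x n e₁ e₂ hon
  set S : Set (ℝ × (ℝ × ℝ)) := {p | p.1 ^ 2 + p.2.1 ^ 2 + p.2.2 ^ 2 < ρ ^ 2} with hS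
  have hpre : T ⁻¹' Metric.ball x ρ = S := by
    ext p
    rw [mem_preimage, Metric.mem_ball, dist_eq_norm, hS, mem_setOf_eq,
      show T p - x = p.1 • n + p.2.1 • e₁ + p.2.2 • e₂ by simp only [hT]; abel,
      ← sq_lt_sq₀ (norm_nonneg _) hρ.le, ballFlux_norm_sq hn he₁ he₂ h12 hn1 hn2]
  -- the integrand
  set f : EuclideanSpace ℝ (Fin 3) → ℝ := fun y => ⟪curl v y, n⟫ with hf
  have hfc : Continuous f := by
    rw [hf, ← hcross]
    exact ballFlux_continuous_inner_curl hv e₁ e₂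
  have hfm : AEStronglyMeasurable ((Metric.ball x ρ).indicator f) (Measure.map T volume) :=
    (hfc.measurable.indicator measurableSet_ball).aestronglyMeasurable
  have hind : (Metric.ball x ρ).indicator f ∘ T = S.indicator (f ∘ T) := by
    funext p
    rw [Function.comp_apply, ← indicator_comp_right T, hpre]
  have hint : Integrable (S.indicator (f ∘ T)) := by
    rw [← hind, ← integrable_map_measure hfm hTmp.measurable.aemeasurable, hTmp.map_eq]
    exact ((hfc.continuousOn.integrableOn_compact (isCompact_closedBall x ρ)).mono_set
      Metric.ball_subset_closedBall).integrable_indicator measurableSet_ball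
  -- Step A: change of variables and Fubini
  have hA : ∫ y in Metric.ball x ρ, f y = ∫ h, ∫ q, S.indicator (f ∘ T) (h, q) := by
    have h1 := integral_map hTmp.measurable.aemeasurable hfm
    rw [hTmp.map_eq] at h1
    rw [← integral_indicator measurableSet_ball, h1,
      show (fun p => (Metric.ball x ρ).indicator f (T p)) = S.indicator (f ∘ T) from hind,
      Measure.volume_eq_prod ℝ (ℝ × ℝ), integral_prod _ hint]
  -- Step B: the slices
  have hB : ∀ h ∈ Ioo (-ρ) ρ, ‖∫ q, S.indicator (f ∘ T) (h, q)‖ ≤ ε := by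
    intro h hh
    have hh2 : h ^ 2 < ρ ^ 2 := sq_lt_sq' hh.1 hh.2
    set R := √(ρ ^ 2 - h ^ 2) with hR
    have hRpos : 0 < R := Real.sqrt_pos.2 (by linarith)
    have hR2 : R ^ 2 = ρ ^ 2 - h ^ 2 := Real.sq_sqrt (by linarith)
    have hRδ : R ≤ δ :=
      calc R ≤ √(ρ ^ 2) := Real.sqrt_le_sqrt (by nlinarith)
        _ = ρ := Real.sqrt_sq hρ.le
        _ ≤ δ := hρδ
    have hDm : MeasurableSet {q : ℝ × ℝ | q.1 ^ 2 + q.2 ^ 2 < R ^ 2} :=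
      (isOpen_lt (by fun_prop) continuous_const).measurableSet
    have hslice : (fun q => S.indicator (f ∘ T) (h, q)) =
        {q : ℝ × ℝ | q.1 ^ 2 + q.2 ^ 2 < R ^ 2}.indicator fun q =>
          ⟪curl v (x + h • n + q.1 • e₁ + q.2 • e₂), cross e₁ e₂⟫ := by
      funext q
      have hiff : (h, q) ∈ S ↔ q ∈ {q : ℝ × ℝ | q.1 ^ 2 + q.2 ^ 2 < R ^ 2} := by
        simp only [hS, mem_setOf_eq, hR2]
        constructor <;> intro <;> linarith
      by_cases hq : (h, q) ∈ S
      · rw [indicator_of_mem hq, indicator_of_mem (hiff.1 hq), hcross]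
        rfl
      · rw [indicator_of_notMem hq, indicator_of_notMem (mt hiff.2 hq)]
    rw [hslice, integral_indicator hDm, ballFlux_disc hv (x + h • n) e₁ e₂ hRpos, Real.norm_eq_abs]
    exact hcirc (x + h • n) e₁ e₂ R hRpos hRδ he₁ he₂ h12
  have hB' : ∀ h, h ∉ Ioo (-ρ) ρ → ∫ q, S.indicator (f ∘ T) (h, q) = 0 := by
    intro h hh
    have hzero : ∀ q, S.indicator (f ∘ T) (h, q) = 0 := fun q => by
      apply indicator_of_notMem
      simp only [hS, mem_setOf_eq, not_lt]
      simp only [mem_Ioo, not_and_or, not_lt] at hh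
      rcases hh with hh | hh <;> nlinarith [sq_nonneg q.1, sq_nonneg q.2]
    simp [hzero]
  -- conclusion
  rw [hA, ← setIntegral_eq_integral_of_forall_compl_eq_zero hB']
  have key := norm_setIntegral_le_of_norm_le_const (measure_Ioo_lt_top (μ := volume)) hB
  rw [Real.volume_real_Ioo_of_le (by linarith), Real.norm_eq_abs] at key
  calc _ ≤ ε * (ρ - -ρ) := key
    _ = 2 * ρ * ε := by ring

end Summit.NavierStokesRegularity.NavierStokesRegularity.Theorems.CirculationFloor.Birth

end
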